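import Literature.Probability.Percolation.TwoGhostInequalityProofs
import Literature.Probability.Percolation.InequalitiesProofs
import HarnessLib

/-!
# Crux `PercRayRenewal.JumpLineAvoidanceDecay` (stmt-CriticalPhenomena-4626) — stub
`theta_mul_real_touchCard_finite_sub_cov_le` (c9-S2, the Harris–FKG lower bound)

Helper file of the line `registered` of the crux `JumpLineAvoidanceDecay`; lands with
`--supports stmt-CriticalPhenomena-4626` (registered structural stub c9-S2 of `Lines/birth.lean`).

## Statement

Bernoulli bond percolation on `ℤ^d` (every `d`, every density `p`, every site `v`). Write
`θ = θ(p) = P_p(|C(0)| = ∞)`, `E(K)` for the set of lattice edges with an endpoint in `K`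
(`TwoGhost.touch`), `f = P_p(n ≤ |E(C(0))|, C(0) finite)`, `τ = P_p(|C(0)| = ∞, |C(v)| = ∞)` and
`R = {0 ↮ v, n ≤ |E(C(0))|, n ≤ |E(C(v))|}`. Then `θ · f − (τ − θ²) ≤ P_p(R)`.

## Proof (Hutchcroft, arXiv:1808.08940 §4, the Harris–FKG step, run at an arbitrary density)

Let `B₀ = {n ≤ |E(C(0))|}` (increasing, measurable) and `P_x = {|C(x)| = ∞}` (increasing,
measurable). For `d ≥ 1` an infinite cluster touches infinitely many edges, so `P₀ ⊆ B₀` and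
`P(B₀) = P(P₀) + P(B₀ \ P₀) = θ + f`. Harris–FKG (`harris_fkg_holds`, Grimmett 1999 Thm. (2.4))
gives `P(B₀) P(P_v) ≤ P(B₀ ∩ P_v)`, and `P(P_v) = θ` by translation invariance
(`theta_zdGraph_eq_theta_zero`). Finally `B₀ ∩ P_v ⊆ R ∪ (P₀ ∩ P_v)`: on `B₀ ∩ P_v \ P₀` the cluster
`C(0)` is finite and `C(v)` is infinite, so `0 ↮ v` (connected sites have the same cluster), while
`|E(C(v))| = ∞ ≥ n`. Hence `θ (θ + f) ≤ P(R) + τ`, which is the claim. For `d = 0` (one site, no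
edges) `θ = 0` (`theta_zdGraph_zero`) and the left side is `−τ ≤ 0 ≤ P(R)`.

## References

* T. Hutchcroft, *Locality of the critical probability for transitive graphs of exponential
  growth*, Ann. Probab. 48 (2020), arXiv:1808.08940, §4 [Hutchcroft2020Locality].
* G. Grimmett, *Percolation*, 2nd ed., Springer (1999), Thm. (2.4) [GrimmettPercolation1999].
-/

noncomputable section

namespace Summit.CriticalPhenomena.PercolationContinuityZ3.Theorems

open MeasureTheory Literature.Probability.Percolation Literature.Probability.LatticeModels

namespace TwoGhostHarris

/-- `{|C(x)| = ∞} ⊆ {n ≤ |E(C(x))|}` on `ℤ^d`, `d ≥ 1`: an infinite cluster touches infinitely many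
edges (`TwoGhost.touch_infinite`), so `|E(C(x))| = ⊤ ≥ n`. [folklore] -/
theorem percolatesAt_subset_le_encard_touch {d : ℕ} (hd : 1 ≤ d) (n : ℕ) (x : Site d) :
    (percolatesAt x : Set (BondConfig (Site d))) ⊆
      {ω | (n : ℕ∞) ≤ (TwoGhost.touch (zdGraph d) (openCluster ω x)).encard} := by
  intro ω hω
  have hinf : (TwoGhost.touch (zdGraph d) (openCluster ω x)).Infinite :=
    TwoGhost.touch_infinite hd hω
  simp only [Set.mem_setOf_eq, hinf.encard_eq, le_top]

/-- `{n ≤ |E(C(x))|}` is an increasing event: adding open edges enlarges `C(x)`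
(`openCluster_mono`), hence `E(C(x))` (`TwoGhost.touch_mono`) and its cardinality. [folklore] -/
theorem isUpperSet_le_encard_touch {d : ℕ} (n : ℕ) (x : Site d) :
    IsUpperSet {ω : BondConfig (Site d) |
      (n : ℕ∞) ≤ (TwoGhost.touch (zdGraph d) (openCluster ω x)).encard} :=
  fun _ _ hle hω =>
    le_trans hω (Set.encard_le_encard (TwoGhost.touch_mono (openCluster_mono hle x)))

/-- Connected sites have the same open cluster, so if `C(x)` is finite and `C(v)` is infinite then
`x ↮ v`. [folklore] -/
theorem not_reachable_of_finite_of_infinite {d : ℕ} {ω : BondConfig (Site d)} {x v : Site d}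
    (hx : (openCluster ω x).Finite) (hv : (openCluster ω v).Infinite) :
    ¬ (openGraph ω).Reachable x v := by
  intro h
  have hvx : v ∈ openCluster ω x := h
  rw [← TwoGhost.openCluster_eq_of_mem hvx] at hx
  exact hv hx

/-- The pointwise inclusion behind the Harris step (`d ≥ 1`):
`{n ≤ |E(C(0))|} ∩ {|C(v)| = ∞} ⊆ R ∪ ({|C(0)| = ∞} ∩ {|C(v)| = ∞})` with
`R = {0 ↮ v, n ≤ |E(C(0))|, n ≤ |E(C(v))|}`: off `{|C(0)| = ∞}` the cluster of `0` is finite and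
that of `v` infinite, so `0 ↮ v` and `|E(C(v))| = ∞`.
[cite: Hutchcroft2020Locality, §4 (Harris–FKG step)] -/
theorem le_encard_touch_inter_percolatesAt_subset {d : ℕ} (hd : 1 ≤ d) (n : ℕ) (v : Site d) :
    {ω : BondConfig (Site d) |
        (n : ℕ∞) ≤ (TwoGhost.touch (zdGraph d) (openCluster ω (0 : Site d))).encard} ∩
        percolatesAt v ⊆
      {ω | ¬ (openGraph ω).Reachable (0 : Site d) v ∧
          (n : ℕ∞) ≤ (TwoGhost.touch (zdGraph d) (openCluster ω (0 : Site d))).encard ∧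
          (n : ℕ∞) ≤ (TwoGhost.touch (zdGraph d) (openCluster ω v)).encard} ∪
        (percolatesAt (0 : Site d) ∩ percolatesAt v) := by
  rintro ω ⟨hB, hPv⟩
  by_cases h0 : ω ∈ percolatesAt (0 : Site d)
  · exact Or.inr ⟨h0, hPv⟩
  · have hfin : (openCluster ω (0 : Site d)).Finite := Set.not_infinite.1 h0
    refine Or.inl ⟨not_reachable_of_finite_of_infinite hfin hPv, hB, ?_⟩
    exact percolatesAt_subset_le_encard_touch hd n v hPv

/-- `P_p(n ≤ |E(C(0))|) = θ(p) + P_p(n ≤ |E(C(0))|, C(0) finite)` (`d ≥ 1`): split the event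
`{n ≤ |E(C(0))|}` along its subset `{|C(0)| = ∞}` (`measureReal_inter_add_sdiff`). [folklore] -/
theorem real_le_encard_touch_eq {d : ℕ} (hd : 1 ≤ d) (p : unitInterval) (n : ℕ) :
    (bondPercolation (zdGraph d) p).real
        {ω | (n : ℕ∞) ≤ (TwoGhost.touch (zdGraph d) (openCluster ω (0 : Site d))).encard} =
      theta (zdGraph d) (0 : Site d) p +
        (bondPercolation (zdGraph d) p).real
          {ω | (n : ℕ∞) ≤ (TwoGhost.touch (zdGraph d) (openCluster ω (0 : Site d))).encard ∧
            (openCluster ω (0 : Site d)).Finite} := by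
  have hm : MeasurableSet (percolatesAt (0 : Site d) : Set (BondConfig (Site d))) :=
    measurableSet_percolatesAt_holds (0 : Site d)
  rw [← measureReal_inter_add_sdiff (μ := bondPercolation (zdGraph d) p)
    (s := {ω | (n : ℕ∞) ≤ (TwoGhost.touch (zdGraph d) (openCluster ω (0 : Site d))).encard}) hm]
  congr 1
  · rw [Set.inter_eq_right.2 (percolatesAt_subset_le_encard_touch hd n 0)]
    rfl
  · congr 1
    ext ω
    simp only [Set.mem_sdiff, Set.mem_setOf_eq, percolatesAt, Set.not_infinite]

/-- **The Harris–FKG step** (`d ≥ 1`): `(θ + f) · θ ≤ P_p(R) + τ` with the notation of the file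
header. Harris–FKG (`harris_fkg_holds`) for the increasing measurable events `{n ≤ |E(C(0))|}`
(probability `θ + f`, `real_le_encard_touch_eq`) and `{|C(v)| = ∞}` (probability `θ`,
`theta_zdGraph_eq_theta_zero`), then the inclusion `le_encard_touch_inter_percolatesAt_subset` and
subadditivity. [cite: Hutchcroft2020Locality, §4 (Harris–FKG step)] -/
theorem add_mul_theta_le {d : ℕ} (hd : 1 ≤ d) (p : unitInterval) (n : ℕ) (v : Site d) :
    (theta (zdGraph d) (0 : Site d) p +
        (bondPercolation (zdGraph d) p).real
          {ω | (n : ℕ∞) ≤ (TwoGhost.touch (zdGraph d) (openCluster ω (0 : Site d))).encard ∧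
            (openCluster ω (0 : Site d)).Finite}) *
        theta (zdGraph d) (0 : Site d) p ≤
      (bondPercolation (zdGraph d) p).real
          {ω | ¬ (openGraph ω).Reachable (0 : Site d) v ∧
            (n : ℕ∞) ≤ (TwoGhost.touch (zdGraph d) (openCluster ω (0 : Site d))).encard ∧
            (n : ℕ∞) ≤ (TwoGhost.touch (zdGraph d) (openCluster ω v)).encard} +
        (bondPercolation (zdGraph d) p).real (percolatesAt (0 : Site d) ∩ percolatesAt v) := by
  -- Harris–FKG for `B₀ = {n ≤ |E(C(0))|}` and `P_v = {|C(v)| = ∞}`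
  have hH := harris_fkg_holds (zdGraph d) p (isUpperSet_le_encard_touch n (0 : Site d))
    (isUpperSet_percolatesAt v) (TwoGhost.measurableSet_le_encard_touch hd n (0 : Site d))
    (measurableSet_percolatesAt_holds v)
  -- `P(P_v) = θ_v = θ_0`
  have hθv : (bondPercolation (zdGraph d) p).real (percolatesAt v) =
      theta (zdGraph d) (0 : Site d) p := theta_zdGraph_eq_theta_zero p v
  -- `P(B₀ ∩ P_v) ≤ P(R) + P(P₀ ∩ P_v)`
  have hU := (measureReal_mono (μ := bondPercolation (zdGraph d) p)
    (le_encard_touch_inter_percolatesAt_subset hd n v)).trans (measureReal_union_le _ _)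
  rw [real_le_encard_touch_eq hd p n, hθv] at hH
  exact hH.trans hU

end TwoGhostHarris

open TwoGhostHarris in
/-- **Structural stub (c9-S2) — Harris lower bound for the surgery event, every `p`, every `v`.**
`θ(p) · P_p(n ≤ |E(K_0)|, K_0 finite) - Cov_p(0, v) ≤ P_p(0 ↮ v, |E(K_0)| ≥ n, |E(K_v)| ≥ n)` with
`Cov_p(0, v) = P_p(0 ∈ C_∞, v ∈ C_∞) - θ(p)²`: Harris–FKG (`harris_fkg_holds`) for the increasing
events `{|E(K_0)| ≥ n}` (probability `θ + P_p(n ≤ |E(K_0)|, K_0 finite)`, as an infinite cluster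
touches infinitely many edges) and `{v ∈ C_∞}` (probability `θ`, `theta_zdGraph_eq_theta_zero`),
plus the inclusion
`{|E(K_0)| ≥ n} ∩ {v ∈ C_∞} ⊆ {0 ↮ v, |E(K_0)| ≥ n, |E(K_v)| ≥ n} ∪ {0 ∈ C_∞, v ∈ C_∞}`
(`TwoGhostHarris.add_mul_theta_le`); for `d = 0` there is no infinite cluster and `θ = 0`.
[cite: Hutchcroft2020Locality, §4 (Harris–FKG step)] -/
theorem theta_mul_real_touchCard_finite_sub_cov_le {d : ℕ} (p : unitInterval) (n : ℕ) (v : Site d) :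
    theta (zdGraph d) (0 : Site d) p *
          (bondPercolation (zdGraph d) p).real
            {ω | (n : ℕ∞) ≤ {e ∈ (zdGraph d).edgeSet | ∃ w ∈ e, w ∈ openCluster ω (0 : Site d)}.encard ∧
                 (openCluster ω (0 : Site d)).Finite}
        - ((bondPercolation (zdGraph d) p).real (percolatesAt (0 : Site d) ∩ percolatesAt v)
            - theta (zdGraph d) (0 : Site d) p ^ 2)
      ≤ (bondPercolation (zdGraph d) p).real
          {ω | ¬ (openGraph ω).Reachable (0 : Site d) v ∧
               (n : ℕ∞) ≤ {e ∈ (zdGraph d).edgeSet | ∃ w ∈ e, w ∈ openCluster ω (0 : Site d)}.encard ∧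
               (n : ℕ∞) ≤ {e ∈ (zdGraph d).edgeSet | ∃ w ∈ e, w ∈ openCluster ω v}.encard} := by
  rcases Nat.eq_zero_or_pos d with rfl | hd
  · -- `d = 0`: a single site, every cluster is finite, `θ = 0`; the left side is `-τ ≤ 0`.
    refine le_trans ?_ measureReal_nonneg
    have hτ : 0 ≤ (bondPercolation (zdGraph 0) p).real
        (percolatesAt (0 : Site 0) ∩ percolatesAt v) := measureReal_nonneg
    rw [theta_zdGraph_zero]
    linarith
  · -- `d ≥ 1`: the Harris–FKG step (`TwoGhost.touch G K` unfolds to the set in the statement).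
    have key := add_mul_theta_le hd p n v
    unfold TwoGhost.touch at key
    linarith

end Summit.CriticalPhenomena.PercolationContinuityZ3.Theorems

end
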